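import Summits.QuantumFields.YangMills.Theses.QuantileBitPurity
import Summits.QuantumFields.YangMills.Theorems.ToronSmallBallOwnAxisShiftWindowGen
import Summits.QuantumFields.YangMills.Theorems.ToronSmallBallOwnAxisShiftNumericsR
import HarnessLib

/-!
# `QuantileBitPurity.HolonomyLevyWindowDeepR` (item stmt-QuantumFields-24092) — PROVED

Route `QuantileBitPurity` crux r3 (RETYPE of the deep Lévy window ⟨23949⟩ with centres restricted away from the equator): for every hand-over exponent
`γc ≤ 2/5` there is `a₀ = 1/400` such that for every window exponent `0 < a ≤ a₀`, with `γ = 1/2 − 4a < 1/2 − 3a`, for `β ≥ β₀(a)`, every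
`2 ≤ L ≤ β^a` and every centre `β^(−γc) ≤ c ≤ 2 − β^(−γc)`, the ring-inserted trace of the slice-`0` strip `{|polDist U − c| ≤ β^(−γ)}` on the
`L`-ring is `≤ β^(−a) · Z_phys(L)`.

METHOD (seat ym-dw-p1 g15, modules `Theorems/ToronSmallBallOwnAxisShift*`): sector decomposition of the ring trace
(`TT.ringInsTrace_indicator_zero_eq_sum_sectorWeight`, eight `(ℤ/2)³` flux sectors, each weight `≥ 0`).  In the four sectors WITH `x`-twist the strip
lies below the level `c + w < 2 − L²η` and is carried by the bad fields (`OwnAxis.sectorWeight_twisted_le_rpow_of_numerics`, from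
`TT.sectorWeight_indicator_polDist_le_of_twisted`).  In the four sectors WITHOUT `x`-twist the strip is off-core with radius `c₀ = c − 2w ≥ β^(−2/5) − 2w`
and the OWN-AXIS CLASS SHIFT applies verbatim with the constant (hence shift-invariant) slice functional `f ≡ c`
(`OwnAxis.sectorWeight_stripGen_le_rpow_of_numerics`: every `x`-line of every slice is rotated about the axis of its own holonomy, classes move by
exactly `θ`, second-order cost, Jacobian `≤ 2`, `K = ⌈64eβ^a⌉` pairwise disjoint angular translates, bad-field complement).  The numeric inequalities
hold for `β ≥ β₀(a)` (`OwnAxis.numericsR_of_le`).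

HONEST FRAMING: one crux of route `QuantileBitPurity`; its cruxes `HolonomyQuantileSubQuartic` and `EquatorBandVanishing` are NOT touched here;
fixed-lattice estimate, nothing about infinite volume or the continuum limit; the Yang–Mills mass gap is NOT proved.  No `sorry`, no new axiom, no new
definition.  References: [cite: Luscher1983, §2]; [cite: tHooft1979]; [cite: MontvayMunster1994, (3.145)]; [cite: MadrasSokal1988, §2].
-/

set_option autoImplicit false

noncomputable section

open MeasureTheory Set Function
open scoped BigOperators
open Literature.MathematicalPhysics.QuantumFieldTheory hiding su2Quat_mul SU2
open Summit.QuantumFields.YangMills.Theorems.FemtoTransferGap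
open Summit.QuantumFields.YangMills.Theorems.FemtoTransferGap.TT
open Summit.QuantumFields.YangMills.Theorems.FemtoTransferGap.FlatSheet

namespace Summit.QuantumFields.YangMills.Theorems.QuantileBitPurity

set_option maxHeartbeats 800000 in
/-- ★ **`QuantileBitPurity.HolonomyLevyWindowDeepR` holds** (item stmt-QuantumFields-24092, BY NAME): the restricted deep Lévy window, by the sector
decomposition and the own-axis class shift (`a₀ = 1/400`, `γ = 1/2 − 4a`, `L₀ = 2`).  No summit conjunct is touched; the Yang–Mills mass gap is NOT
proved. [cite: Luscher1983, §2] [cite: tHooft1979] [cite: MontvayMunster1994, (3.145)] -/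
theorem holonomyLevyWindowDeepR_proof : Summit.QuantumFields.YangMills.Theses.QuantileBitPurity.HolonomyLevyWindowDeepR := by
  intro γc hγc
  refine ⟨1 / 400, by norm_num, by norm_num, fun a ha ha' => ?_⟩
  obtain ⟨β₀, hβ₀⟩ := OwnAxis.numericsR_of_le ha ha'
  refine ⟨1 / 2 - 4 * a, by linarith, β₀, 2, fun β hβ L _ hL2 hLβ c hc1 hc2 => ?_⟩
  have hL1 : 1 ≤ L := le_trans (by norm_num) hL2
  obtain ⟨⟨h200, hη, hw, hθ', hσ, hσ1, -, hK, hKσ, hQ, hJ, hG, hKa⟩, hstrip⟩ := hβ₀ β hβ L hL1 hLβ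
  have hβ1 : 1 ≤ β := by linarith
  -- the core exponent: `β^{-2/5} ≤ β^{-γc} ≤ c ≤ 2 - β^{-γc} ≤ 2 - β^{-2/5}`
  have hcore : β ^ (-(2 / 5 : ℝ)) ≤ β ^ (-γc) := Real.rpow_le_rpow_of_exponent_le hβ1 (by linarith)
  have hc1' : β ^ (-(2 / 5 : ℝ)) ≤ c := hcore.trans hc1
  have hc2' : c ≤ 2 - β ^ (-(2 / 5 : ℝ)) := by linarith
  -- the ring: `n = L - 1`, `n + 1 = L ≤ 2L`
  have hn1 : 1 ≤ L - 1 := by omega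
  have hn2 : L - 1 + 1 ≤ 2 * L := by omega
  have hZ : physTrace L β L = physTraceSucc L β (L - 1) := rfl
  have hZ0 : 0 ≤ physTraceSucc L β (L - 1) := OwnAxis.physTraceSucc_nonneg_of (L := L) hn1 h200
  have ha0 : 0 < β ^ (-a) := Real.rpow_pos_of_pos (by linarith) _
  have hLLη : 0 ≤ (L : ℝ) * (L * β ^ (-(19 / 40 : ℝ))) := by positivity
  -- the strip event and its two envelopes
  have hA : MeasurableSet {U : GaugeConfig 3 L SU2 | |polDist U - c| ≤ β ^ (-(1 / 2 - 4 * a))} :=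
    measurableSet_le ((measurable_polDist.sub measurable_const).abs) measurable_const
  have hFm : Measurable (uncurry fun (Us : Fin (L - 1 + 1) → GaugeConfig 3 L SU2) (_g : Site 3 L → SU2) =>
      {U : GaugeConfig 3 L SU2 | |polDist U - c| ≤ β ^ (-(1 / 2 - 4 * a))}.indicator (fun _ => (1 : ℝ)) (Us 0)) :=
    measurable_uncurry_slice_zero (measurable_const.indicator hA)
  rw [ringInsTrace_indicator_zero_eq_sum_sectorWeight β (L - 1) hA, hZ]
  -- every sector carries at most `β^{-a} Z_phys`
  have hsector : ∀ z : Fin 3 → Bool,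
      sectorWeight β (L - 1) z (fun Us _ =>
        {U : GaugeConfig 3 L SU2 | |polDist U - c| ≤ β ^ (-(1 / 2 - 4 * a))}.indicator (fun _ => (1 : ℝ)) (Us 0)) ≤
      β ^ (-a) * physTraceSucc L β (L - 1) := by
    intro z
    cases hz : z 0
    · -- no `x`-twist: the own-axis class shift with the constant slice functional `f ≡ c` and core radius `c - 2w`
      have hsub : {U : GaugeConfig 3 L SU2 | |polDist U - c| ≤ β ^ (-(1 / 2 - 4 * a))} ⊆
          {U : GaugeConfig 3 L SU2 | |polDist U - (fun _ : GaugeConfig 3 L SU2 => c) U| ≤ β ^ (-(1 / 2 - 4 * a)) ∧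
            c - 2 * β ^ (-(1 / 2 - 4 * a)) < polDist U} := by
        intro U hU
        simp only [Set.mem_setOf_eq] at hU ⊢
        refine ⟨hU, ?_⟩
        have h := (abs_le.1 hU).1
        linarith
      have hGm : Measurable (uncurry fun (Us : Fin (L - 1 + 1) → GaugeConfig 3 L SU2) (_g : Site 3 L → SU2) =>
          {U : GaugeConfig 3 L SU2 | |polDist U - (fun _ : GaugeConfig 3 L SU2 => c) U| ≤ β ^ (-(1 / 2 - 4 * a)) ∧
            c - 2 * β ^ (-(1 / 2 - 4 * a)) < polDist U}.indicator (fun _ => (1 : ℝ)) (Us 0)) :=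
        measurable_uncurry_slice_zero (measurable_const.indicator (OwnAxis.measurableSet_stripGen (L := L) measurable_const _ _))
      have hmono := sectorWeight_mono (L := L) β (L - 1) z (C := 1) hFm hGm
        (fun Us _ => abs_indicator_one_le _ (Us 0)) (fun Us _ => abs_indicator_one_le _ (Us 0))
        (fun Us _ => Set.indicator_le_indicator_of_subset hsub (fun _ => zero_le_one) (Us 0))
      have hfl : 4 * ((L : ℝ) * (L * β ^ (-(19 / 40 : ℝ)))) ≤ (c - 2 * β ^ (-(1 / 2 - 4 * a))) / 2 - β ^ (-(2 / 5 : ℝ)) / 4 := by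
        linarith
      have hwin := OwnAxis.sectorWeight_stripGen_le_rpow_of_numerics (L := L) hz (f := fun _ : GaugeConfig 3 L SU2 => c) measurable_const
        (fun _ _ => rfl) hn1 hn2 (a := a) (η := β ^ (-(19 / 40 : ℝ))) (w := β ^ (-(1 / 2 - 4 * a)))
        (c₀ := c - 2 * β ^ (-(1 / 2 - 4 * a))) (σ := β ^ (-(2 / 5 : ℝ)) / 4) (θ' := 6 * β ^ (-(1 / 2 - 4 * a))) (K := ⌈64 * Real.exp 1 * β ^ a⌉₊)
        h200 hη hw hθ' hσ hσ1 hfl hK hKσ hQ hJ hG hKa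
      exact hmono.trans hwin
    · -- `x`-twist: the strip lies below the level `c + w < 2 - L² η`, a bad-field event
      have hsub : {U : GaugeConfig 3 L SU2 | |polDist U - c| ≤ β ^ (-(1 / 2 - 4 * a))} ⊆
          {U : GaugeConfig 3 L SU2 | polDist U ≤ c + β ^ (-(1 / 2 - 4 * a))} := by
        intro U hU
        simp only [Set.mem_setOf_eq] at hU ⊢
        have h := (abs_le.1 hU).2
        linarith
      have hGm : Measurable (uncurry fun (Us : Fin (L - 1 + 1) → GaugeConfig 3 L SU2) (_g : Site 3 L → SU2) =>
          {U : GaugeConfig 3 L SU2 | polDist U ≤ c + β ^ (-(1 / 2 - 4 * a))}.indicator (fun _ => (1 : ℝ)) (Us 0)) :=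
        measurable_uncurry_slice_zero (measurable_const.indicator (measurableSet_le measurable_polDist measurable_const))
      have hmono := sectorWeight_mono (L := L) β (L - 1) z (C := 1) hFm hGm
        (fun Us _ => abs_indicator_one_le _ (Us 0)) (fun Us _ => abs_indicator_one_le _ (Us 0))
        (fun Us _ => Set.indicator_le_indicator_of_subset hsub (fun _ => zero_le_one) (Us 0))
      have hLn : (((L - 1 : ℕ) : ℝ) + 1) = L := by
        have h : L - 1 + 1 = L := Nat.sub_add_cancel hL1
        exact_mod_cast h
      have hc' : c + β ^ (-(1 / 2 - 4 * a)) < 2 - L * ((((L - 1 : ℕ) : ℝ) + 1) * β ^ (-(19 / 40 : ℝ))) := by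
        rw [hLn]
        nlinarith
      have htw := OwnAxis.sectorWeight_twisted_le_rpow_of_numerics (L := L) hz hn1 hn2 (a := a) h200 hη.le hc' hG
      have hhalf : β ^ (-a) / 2 * physTraceSucc L β (L - 1) ≤ β ^ (-a) * physTraceSucc L β (L - 1) := by nlinarith
      exact hmono.trans (htw.trans hhalf)
  -- sum over the eight sectors
  have hsum := Finset.sum_le_sum fun z (_ : z ∈ (Finset.univ : Finset (Fin 3 → Bool))) => hsector z
  rw [Finset.sum_const, Finset.card_univ, Fintype.card_fun, Fintype.card_bool, Fintype.card_fin, nsmul_eq_mul] at hsum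
  rw [show ((2 ^ 3 : ℕ) : ℝ) = 8 by norm_num] at hsum
  linarith

end Summit.QuantumFields.YangMills.Theorems.QuantileBitPurity

end
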